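import Mathlib
import HarnessLib
import Summits.BirchSwinnertonDyer.BirchSwinnertonDyer.Theses.ManinLocalTwoThree
import Summits.BirchSwinnertonDyer.BirchSwinnertonDyer.Theorems.ManinLocalTwoThreeSixteenSplitCore
import Summits.BirchSwinnertonDyer.Rank1Residual.ManinAdditive.KatoShiftTwoCoreLaws
import Literature.NumberTheory.EllipticCurves.KatoAdditiveTwistedValueNeronIntegralityTwoReal
import Literature.NumberTheory.EllipticCurves.KatoAdditiveTwistedValueNeronIntegralitySymbolClosure
import Literature.NumberTheory.EllipticCurves.Gamma1ParametrizationCuspRationality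
import Literature.NumberTheory.EllipticCurves.ManinConstantGamma1Gamma0Comparison

/-!
# C2 (`ManinOddAtFour`) and its `16 ∣ N` core BY NAME — the conditional reduction of record as one tree theorem

Lead p1 gen 13 (route `ManinLocalTwoThree`, crux item stmt-BirchSwinnertonDyer-22967).  The C2 skeleton of record (crux workfile
`Cruxes/ManinOddAtFour/Lines/kato_shift_two.lean`, v21) has SEVEN stubs, every one of them a NAMED tree declaration:

* four statement-only Literature facts — F♯ `kato_neron_isIntegral_twistedSymbolSum_of_additive_two_real` (Kato's `p = 2`
  integrality over the real subfield), F★ `optimalGamma1Parametrization_cusp_rational` (CES 2003 §6), hex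
  `exists_optimal_gamma1ParametrizationData` (Stevens 1989 §2), F-es-21♭K `kato_isIntegral_twistedSymbolSum_two_symbolClosure`
  (Kato 2004 (8.1.3) + Thm 12.5 (1));
* three OPEN `@[conjecture]` laws on the CORE {`2 ^ 4 ∣ N`} ∩ {`ord₂ j > 0`} ∩ {no dyadic twist is 2-semistable} (typer p708603,
  `Summits/BirchSwinnertonDyer/Rank1Residual/ManinAdditive/KatoShiftTwoCoreLaws.lean`): 6a‴ `CuspidalKummer.CuspidalKummerRepresentativeOnCore`
  (E-an-48 on the core), 6b‴ `CuspidalKummer.CuspidalKummerOddExponentOnCore` (E-an-53 on the core), 6♭‴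
  `KatoCurve.KatoNeronIntegralTwoGamma1OptimalOnBlindCore` (E-es-110 on the totally blind, non-period-dominated core classes).

This file records the composition AS A SORRY-FREE CONDITIONAL THEOREM with the seven named nodes as hypotheses, so that the
reduction «C2 ⟸ seven named nodes» is citable by name (the skeleton itself carries `sorry`s and is not importable).  The proof is
the lead's composition `maninOddAtFour_of_katoFact_of_levelSixteenCoreLaws_blindPeriodRecut` (p706201): the three named laws unfold
definitionally to its inline hypotheses.  The `16 ∣ N` core statement is recorded too (`maninOddAtSixteenCore_of_namedCoreLaws`).

HONEST FRAMING: both theorems are CONDITIONAL on three OPEN laws and four unproved statement-only facts; nothing here proves C2,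
Manin's conjecture at `2`, or BSD.  beyond-print theorem: NO.  bears_on: stmt-BirchSwinnertonDyer-22967.
-/

set_option linter.dupNamespace false

open scoped Classical MatrixGroups ModularForm NumberField
open IsDedekindDomain IsDedekindDomain.HeightOneSpectrum Rat.HeightOneSpectrum
open PowerSeries CongruenceSubgroup WeierstrassCurve Literature.NumberTheory.EllipticCurves
  Literature.NumberTheory.EllipticCurves.ModularForms
  Summit.BirchSwinnertonDyer.Rank1Residual.ManinAdditive
  Summit.BirchSwinnertonDyer.Rank1Residual.ManinAdditive.CuspidalKummer
  Summit.BirchSwinnertonDyer.Rank1Residual.ManinAdditive.ShimuraLedger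

namespace Summit.BirchSwinnertonDyer.BirchSwinnertonDyer.Theorems.ManinLocalTwoThree

/-- **C2 BY NAME (conditional).**  The route declaration `ManinOddAtFour` (`4 ∣ N ⟹ 2 ∤ c`) follows from the seven named nodes of
skeleton v21: F♯, F★, hex, F-es-21♭K and the three OPEN core laws 6a‴, 6b‴, 6♭‴ (typer p708603).  One-line proof: the lead's
composition `maninOddAtFour_of_katoFact_of_levelSixteenCoreLaws_blindPeriodRecut`, whose inline law hypotheses are the `@[conjecture]`
defs unfolded.  CONDITIONAL — the three laws are open; BSD is not proved by this. -/
theorem maninOddAtFour_of_namedCoreLaws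
    (hF : kato_neron_isIntegral_twistedSymbolSum_of_additive_two_real)
    (hFstar : optimalGamma1Parametrization_cusp_rational) (hex : exists_optimal_gamma1ParametrizationData)
    (hK : kato_isIntegral_twistedSymbolSum_two_symbolClosure)
    (h6a : CuspidalKummerRepresentativeOnCore) (h6b : CuspidalKummerOddExponentOnCore)
    (h6 : KatoCurve.KatoNeronIntegralTwoGamma1OptimalOnBlindCore) :
    Summit.BirchSwinnertonDyer.BirchSwinnertonDyer.Theses.ManinLocalTwoThree.ManinOddAtFour :=
  maninOddAtFour_of_katoFact_of_levelSixteenCoreLaws_blindPeriodRecut hF hFstar hex hK h6a h6b h6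

/-- **The `16 ∣ N` CORE BY NAME (conditional).**  On the core {`2 ^ 4 ∣ N`} ∩ {`ord₂ j > 0`} ∩ {no dyadic twist of `W` is
2-semistable}, the Manin constant of a lattice-optimal `X₀(N)`-datum is odd, from the same seven named nodes (the level-wise statement
that the χ₋₄ rotation and p2's `maninOddAtFour_of_core` turn into `ManinOddAtFour`).  One-line proof: the lead's
`maninOddAtSixteenCore_of_katoFact_of_levelSixteenCoreLaws_blindPeriodRecut` with the named laws unfolded.  CONDITIONAL. -/
theorem maninOddAtSixteenCore_of_namedCoreLaws
    (hF : kato_neron_isIntegral_twistedSymbolSum_of_additive_two_real)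
    (hFstar : optimalGamma1Parametrization_cusp_rational) (hex : exists_optimal_gamma1ParametrizationData)
    (hK : kato_isIntegral_twistedSymbolSum_two_symbolClosure)
    (h6a : CuspidalKummerRepresentativeOnCore) (h6b : CuspidalKummerOddExponentOnCore)
    (h6 : KatoCurve.KatoNeronIntegralTwoGamma1OptimalOnBlindCore) :
    mazur_not_dvd_maninConstant_of_odd → abbesUllmo_not_dvd_maninConstant_of_not_dvd_level →
      cesnavicius_not_two_dvd_maninConstant_of_two_dvd_level → exists_isNewformOf →
      ∀ (W : WeierstrassCurve ℚ) [W.IsElliptic] [W.IsGloballyMinimal] {N : ℕ} [NeZero N] (D : ModularParametrizationData W N),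
        (∀ z ∈ D.L.lattice, ∃ w ∈ periodLattice D.f, z = D.c * w) → 2 ^ 4 ∣ N →
        ((primesEquiv (R := 𝓞 ℚ)).symm ⟨2, Nat.prime_two⟩).valuation ℚ W.j < 1 →
        (∀ d : ℤ, d = -1 ∨ d = 2 ∨ d = -2 →
          2 ≤ (W.quadraticTwist (d : ℚ)).conductorExponent ((primesEquiv (R := ℤ)).symm ⟨2, Nat.prime_two⟩)) →
        ¬ (2 : ℤ) ∣ D.maninConstant :=
  maninOddAtSixteenCore_of_katoFact_of_levelSixteenCoreLaws_blindPeriodRecut hF hFstar hex hK h6a h6b h6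

end Summit.BirchSwinnertonDyer.BirchSwinnertonDyer.Theorems.ManinLocalTwoThree
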